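import Literature.RepresentationTheory.Virasoro.VermaModule
import Literature.Barriers.CriticalPhenomena.SAWNoUnitaryCFT

/-!
# Virasoro modules at central charge `c = 0` (polymers / self-avoiding walks)

`VirasoroModuleC0 V := VirasoroRep 0 V`: a plain (no inner product) representation of the Virasoro
algebra at central charge `0` on a complex vector space — the kind of object the `c = 0`
(logarithmic) conformal field theory of dilute polymers / the self-avoiding walk lives on, and the
intended LIMIT object of lattice Virasoro modes (Koo–Saleur,
`Literature.MathematicalPhysics.StatisticalMechanics.KooSaleurConvergence`). In contrast with the
unitary structure `Literature.Barriers.CriticalPhenomena.UnitaryCFT.UnitaryVirasoroRep`, no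
positivity is assumed (by the proved barrier `SAWNoUnitaryCFT`, positivity forces triviality at
`c = 0`); `ofUnitary` forgets a unitary representation to a plain one.

`c(t) = 13 - 6(t + t⁻¹)` vanishes iff `t ∈ {3/2, 2/3}` (`centralChargeOf_eq_zero_iff`), and the two
Kac tables at `c = 0` are transposes of each other (`h_{r,s}(2/3) = h_{s,r}(3/2)`, `kacWeight_swap`).
The table in which the polymer / SAW weights of the barrier file and of Cardy 2013 §1.4 are written,
`h_{r,s} = ((3r - 2s)² - 1)/24` (= `kacWeightZero r s`; Di Francesco–Mathieu–Sénéchal (7.34) with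
`m = 2`), is `t = 3/2`: `kacWeight_three_halves`, `kacWeight_three_halves_eq_kacWeightZero`. (In
Kytölä–Ridout's SLE dictionary `κ = 4t`, their Example 1, so the SLE_{8/3} curve corresponds to `t = 2/3`
with the transposed labels; only the labelling, not the set of modules, depends on this choice.) The
boundary `k`-leg (watermelon) operators of the polymer problem have weights
`h_{k+1,1}(3/2) = k(3k + 2)/8 = 0, 5/8, 2, 33/8, …` (Cardy 2013 §1.4: "the boundary `N`-leg operators
… with dimensions `h_{N+1,1}`"; `kacWeight_leg`, `kacWeight_leg_values`), and the corresponding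
Virasoro modules are the Kac quotients `𝒱_k := K_{k+1,1} = V_{h_{k+1,1}}/V_{h_{k+1,1}+k+1}` at
`c = 0`, `t = 3/2` (`PolymerModule k`, with its action `PolymerModule.rep k : VirasoroModuleC0 _`,
generator `PolymerModule.hw k`, proved primary of weight `k(3k+2)/8`; in the vacuum module
`𝒱_0 = V_0/V_1` the relation `L_{-1}Ω = 0` is proved, `PolymerModule.L_neg_one_hw`).

## Not here

Staggered (logarithmic) modules and the indecomposability parameters `b` (`β`) of Kytölä–Ridout /
Gurarie–Ludwig (`b = 5/6` for dilute polymers, `-5/8` for percolation), bulk (`Vir ⊕ Vir`)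
modules, fusion.
-/

noncomputable section

namespace Literature.RepresentationTheory.Virasoro

open Literature.Barriers.CriticalPhenomena.UnitaryCFT

variable {V : Type*} [AddCommGroup V] [Module ℂ V]

/-- A **representation of the Virasoro algebra at central charge `c = 0`** on a complex vector space
(plain: no inner product; `L : ℤ → End V` with `L_m L_n - L_n L_m = (m - n) L_{m+n}`, the central
term vanishing identically at `c = 0`). [cite: KytolaRidout2009, §2 eq. (2.1)]
[cite: Cardy2013, §1.2 (c = 0 for self-avoiding walks)] -/
abbrev VirasoroModuleC0 (V : Type*) [AddCommGroup V] [Module ℂ V] := VirasoroRep 0 V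

namespace VirasoroRep

/-- Transport of a representation along an equality of central charges (e.g. `c(3/2) = 0`).
[folklore] -/
def cast {c c' : ℂ} (R : VirasoroRep c V) (hc : c = c') : VirasoroRep c' V where
  L := R.L
  lie m n x := hc ▸ R.lie m n x

/-- `cast` does not change the generators. [folklore] -/
@[simp] theorem cast_L {c c' : ℂ} (R : VirasoroRep c V) (hc : c = c') : (R.cast hc).L = R.L := rfl

/-- Primary vectors are unchanged by `cast`. [folklore] -/
theorem IsPrimary.cast {c c' : ℂ} {R : VirasoroRep c V} {v : V} {h : ℂ} (hv : R.IsPrimary v h)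
    (hc : c = c') : (R.cast hc).IsPrimary v h :=
  ⟨hv.annihilated, hv.weight⟩

/-- The **weight window** `W_N = Σ_{m ≤ N} V_{h+m}` (generalised `L_0`-weight spaces of weights
`h, h+1, …, h+N`): the finite truncations of a graded module on which the compressed generators
`P L_n P` of scaling-weak limits of lattice Virasoro modes act
(`Literature.MathematicalPhysics.StatisticalMechanics.KooSaleurConvergence`). [folklore] -/
def weightWindow {c : ℂ} (R : VirasoroRep c V) (h : ℂ) (N : ℕ) : Submodule ℂ V :=
  ⨆ (m : ℕ) (_ : m ≤ N), R.genWeightSpace (h + m)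

/-- `V_{h+m} ≤ W_N` for `m ≤ N`. [folklore] -/
theorem genWeightSpace_le_weightWindow {c : ℂ} (R : VirasoroRep c V) (h : ℂ) {m N : ℕ}
    (hm : m ≤ N) : R.genWeightSpace (h + m) ≤ R.weightWindow h N :=
  le_iSup₂_of_le m hm le_rfl

/-- The weight windows increase with `N`. [folklore] -/
theorem weightWindow_mono {c : ℂ} (R : VirasoroRep c V) (h : ℂ) {N N' : ℕ} (hN : N ≤ N') :
    R.weightWindow h N ≤ R.weightWindow h N' :=
  iSup₂_le fun _ hm => R.genWeightSpace_le_weightWindow h (hm.trans hN)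

end VirasoroRep

/-- At `c = 0` the relations are those of the Witt algebra: `L_m L_n x = L_n L_m x + (m - n) L_{m+n} x`.
[cite: KytolaRidout2009, §2 eq. (2.1)] -/
theorem VirasoroModuleC0.comm_apply (R : VirasoroModuleC0 V) (m n : ℤ) (x : V) :
    R.L m (R.L n x) = R.L n (R.L m x) + ((m : ℂ) - n) • R.L (m + n) x := by
  rw [VirasoroRep.comm_apply, centralTerm_zero, zero_smul, add_zero]

/-- A unitary representation of the Virasoro algebra (barrier catalogue) is in particular a plain
one, of central charge `c ∈ ℝ ⊆ ℂ`. [cite: DiFrancescoMathieuSenechal1997, §7.2.1] -/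
def ofUnitary {W : Type*} [NormedAddCommGroup W] [InnerProductSpace ℂ W] (U : UnitaryVirasoroRep W) :
    VirasoroRep (U.c : ℂ) W where
  L := U.L
  lie m n x := by rw [centralTerm]; exact U.lie m n x

/-- Primary vectors of a unitary representation are primary for the underlying plain one. [folklore] -/
theorem ofUnitary_isPrimary {W : Type*} [NormedAddCommGroup W] [InnerProductSpace ℂ W]
    {U : UnitaryVirasoroRep W} {v : W} {h : ℝ} (hv : U.IsPrimary v h) :
    (ofUnitary U).IsPrimary v (h : ℂ) :=
  ⟨hv.annihilated, hv.weight⟩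

/-! ### The Kac table at `c = 0` -/

/-- `c(3/2) = 0`. [cite: KytolaRidout2009, eq. (2.2) and footnote 7 ("c = 0 (t = 3/2)")] -/
theorem centralChargeOf_three_halves : centralChargeOf (3 / 2) = 0 := by
  norm_num [centralChargeOf]

/-- `c(2/3) = 0` (`t ↔ t⁻¹`). [cite: KytolaRidout2009, eq. (2.2)] -/
theorem centralChargeOf_two_thirds : centralChargeOf (2 / 3) = 0 := by
  norm_num [centralChargeOf]

/-- For `t ≠ 0`: `c(t) = 0 ↔ t = 3/2 ∨ t = 2/3`. [cite: KytolaRidout2009, eq. (2.2)] -/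
theorem centralChargeOf_eq_zero_iff {t : ℂ} (ht : t ≠ 0) :
    centralChargeOf t = 0 ↔ t = 3 / 2 ∨ t = 2 / 3 := by
  have key : centralChargeOf t = -(6 / t) * (t - 3 / 2) * (t - 2 / 3) := by
    unfold centralChargeOf
    field_simp
    ring
  rw [key, mul_eq_zero, mul_eq_zero, sub_eq_zero, sub_eq_zero, neg_eq_zero, div_eq_zero_iff]
  constructor
  · rintro ((h | h) | h)
    · rcases h with h | h
      · norm_num at h
      · exact absurd h ht
    · exact Or.inl h
    · exact Or.inr h
  · rintro (h | h)
    · exact Or.inl (Or.inr h)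
    · exact Or.inr h

/-- The Kac table at `c = 0`, `t = 3/2`: `h_{r,s}(3/2) = ((3r - 2s)² - 1)/24`.
[cite: DiFrancescoMathieuSenechal1997, eqs. (7.31) and (7.34) (m = 2)] [cite: Cardy2013, §1.4] -/
theorem kacWeight_three_halves (r s : ℤ) :
    kacWeight (3 / 2) r s = (((3 * r - 2 * s : ℤ) : ℂ) ^ 2 - 1) / 24 := by
  unfold kacWeight
  push_cast
  field_simp
  ring

/-- The `t = 3/2` Kac table at `c = 0` is the barrier catalogue's `kacWeightZero` (cast to `ℂ`).
[cite: Cardy2013, §1.4] -/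
theorem kacWeight_three_halves_eq_kacWeightZero (r s : ℤ) :
    kacWeight (3 / 2) r s = ((kacWeightZero r s : ℝ) : ℂ) := by
  rw [kacWeight_three_halves, kacWeightZero]
  push_cast
  ring

/-- The boundary `k`-leg polymer weights `h_{k+1,1}(3/2) = k(3k + 2)/8`.
[cite: Cardy2013, §1.4 ("the boundary N-leg (watermelon) operators … with dimensions h_{N+1,1}")] -/
theorem kacWeight_leg (k : ℕ) :
    kacWeight (3 / 2) ((k + 1 : ℕ) : ℤ) ((1 : ℕ) : ℤ) = (k : ℂ) * (3 * k + 2) / 8 := by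
  unfold kacWeight
  push_cast
  field_simp
  ring

/-- `h_{1,1} = 0`, `h_{2,1} = 5/8`, `h_{3,1} = 2`, `h_{4,1} = 33/8` at `c = 0`, `t = 3/2`.
[cite: Cardy2013, §1.4] [cite: DiFrancescoMathieuSenechal1997, eq. (7.26) (h_{2,1} = 5/8 at c = 0)] -/
theorem kacWeight_leg_values :
    kacWeight (3 / 2) 1 1 = 0 ∧ kacWeight (3 / 2) 2 1 = 5 / 8 ∧ kacWeight (3 / 2) 3 1 = 2 ∧
      kacWeight (3 / 2) 4 1 = 33 / 8 := by
  refine ⟨?_, ?_, ?_, ?_⟩ <;> norm_num [kacWeight]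

/-! ### The polymer modules `𝒱_k = K_{k+1,1}` at `c = 0` -/

/-- The **`k`-leg polymer module** `𝒱_k := K_{k+1,1} = V(0, h_{k+1,1}) / V(0, h_{k+1,1} + k + 1)`
(`t = 3/2`): the Kac quotient of the boundary `k`-leg operator (`k = 0`: the vacuum module
`V_0/V_1`, containing the stress tensor `T = L_{-2}Ω`; `k = 2`: `V_2/V_5`).
[cite: PearceRasmussenZuber2006, §2.2 (Q_{r,s})] [cite: KytolaRidout2009, footnote 7 (V₀/V₁ and V₂/V₅ at c = 0, t = 3/2)]
[cite: Cardy2013, §1.4] -/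
abbrev PolymerModule (k : ℕ) : Type := KacModule (3 / 2) (k + 1) 1

namespace PolymerModule

variable (k : ℕ)

/-- The Virasoro action on `𝒱_k`, at central charge `0`. [cite: KytolaRidout2009, §2] -/
def rep : VirasoroModuleC0 (PolymerModule k) :=
  (KacModule.rep (3 / 2) (k + 1) 1).cast centralChargeOf_three_halves

/-- The generating vector (boundary `k`-leg state) of `𝒱_k`. [cite: KytolaRidout2009, §2] -/
def hw : PolymerModule k := KacModule.hw (3 / 2) (k + 1) 1

/-- The generating vector of `𝒱_k` is primary of weight `h_{k+1,1} = k(3k + 2)/8`.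
[cite: Cardy2013, §1.4] -/
theorem isPrimary_hw : (rep k).IsPrimary (hw k) ((k : ℂ) * (3 * k + 2) / 8) := by
  rw [← kacWeight_leg]
  exact (KacModule.isPrimary_hw _ _ _).cast _

/-- `𝒱_k` is generated by its `k`-leg state: every vector is a word in the `L_n` applied to it.
[cite: KytolaRidout2009, §2] -/
theorem exists_smul_hw (x : PolymerModule k) :
    ∃ a : FreeAlgebra ℂ ℤ, x = Submodule.Quotient.mk (a • Verma.hw _ _) :=
  KacModule.exists_smul_hw _ _ _ x

/-- In the vacuum module `𝒱_0 = V_0/V_1` the vacuum is translation invariant: `L_{-1} Ω = 0`.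
[cite: KytolaRidout2009, footnote 7 (H^L = V₀/V₁)] [cite: Qualls2015CFT, §3.6 ("the states L_{-n}|0⟩ have zero norm and can therefore be set equal to zero"; here n = 1)] -/
theorem L_neg_one_hw : (rep 0).L (-1) (hw 0) = 0 := by
  have hp := (Verma.isPrimary_hw (c := centralChargeOf (3 / 2))
    (h := kacWeight (3 / 2) ((0 + 1 : ℕ) : ℤ) ((1 : ℕ) : ℤ))).L_neg_one (by norm_num [kacWeight])
  refine KacModule.mk_eq_zero_of_isPrimary (3 / 2) (0 + 1) 1 ?_
  convert hp using 2
  push_cast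
  ring

end PolymerModule

end Literature.RepresentationTheory.Virasoro

end
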